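import Summits.BirchSwinnertonDyer.BirchSwinnertonDyer.Theorems.SignedLowerHalvesSmallImageLowerHalfBothSignsRttKanVatsalLevel
import Summits.BirchSwinnertonDyer.BirchSwinnertonDyer.Theorems.SignedLowerHalvesSmallImageLowerHalfBothSignsRttKanDepletedForm
import Summits.BirchSwinnertonDyer.BirchSwinnertonDyer.Theorems.SignedLowerHalvesSmallImageLowerHalfBothSignsRttKanLayerDepletionExact
import Summits.BirchSwinnertonDyer.BirchSwinnertonDyer.Theorems.KimAtThreeDeepLowerOffStratumLevelLoweringVatsal
import Summits.BirchSwinnertonDyer.Rank1Residual.Additive.PlusSymbolIntegrality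
import Literature.NumberTheory.EllipticCurves.CanonicalPeriodSymbolCongruence
import Literature.NumberTheory.EllipticCurves.NewformGaloisRepModLOfPadicAlgClProofs
import Literature.NumberTheory.EllipticCurves.SupersingularIrreducibleProofs
import Literature.NumberTheory.EllipticCurves.SerreOpenImageOrdinaryInertiaProofs
import Literature.NumberTheory.EllipticCurves.NonEisensteinPrimeOfSurjective
import Literature.NumberTheory.EllipticCurves.LFunctionPrimeCoeff
import HarnessLib

/-!
# Route `SignedLowerHalves`, crux L `SmallImageLowerHalfBothSigns` (item stmt-BirchSwinnertonDyer-23599), line `rtt_w3`,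
# stub Kan₂ `stub_thetaLayerLambda_ns` — brick K9b: Vatsal's canonical-period congruence READ ON THE DEPLETED SYMBOLS

Width seat `bsd-line-slh-p3-w3` g11 under LEAD `cruxlead-stmt-BirchSwinnertonDyer-23599` g0 (cell `bsd-ssimc`). ROUTE-INDEPENDENT
helper (`--supports stmt-BirchSwinnertonDyer-23599`); THEOREMS ONLY — no definition, no `sorry`; closes nothing; BSD is not proved by
any of this. The printed input is TAKEN BY NAME as a hypothesis (`vatsal1999_plusSymbol_congruence`, Vatsal 1999 Thm. (1.6)/(1.13),
exactly as the registered v3 stub text does) — every theorem here that uses it is CONDITIONAL on it.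

* §1 `symm_coeffProd_curve`, `symm_coeffProd_partner` — through `e : ℚ̄_p ≃ ℂ` extending `ι : K_g → ℚ̄_p`, the complex depletion
  coefficients `∏_v coeff_{k_v}(1 − a_{ℓ_v}X + 𝟙ℓ_vX²)·ℓ_v^{−k_v}` of brick K7 become the `ℚ̄_p`-coefficients of bricks K1/K1′
  (`L_v(W,X)` by `map_localPolynomialAt_eq'`; `embCoeff g ι` by `e ∘ ι = id`).
* §2 `symm_depletedSymbol_curve`, `symm_depletedSymbol_partner` — `e⁻¹(plusSymbol f′ x/Ω_f) = u_f · φ^{S₀}_W(x)` and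
  `e⁻¹(plusSymbol g′ x/Ω_g) = u_g · φ^{S₀}_{g,Ω}(x)` with `u_f = e⁻¹(Ω⁺_f/Ω_f)`, `u_g = e⁻¹(Ω/Ω_g)` (`f′, g′` the depleted forms of
  K7, `φ^{S₀}` the depleted symbols of K1′; `plusSymbol f = [·]⁺_f Ω⁺_f`, `plusSymbol g = Ω·[·]⁺_{g,Ω}`).
* §3 `norm_depletedSymbol_curve_le_one` — `‖φ^{S₀}_W(x)‖ ≤ 1` (integral `L_v`, `ℓ_v` units, `[x]⁺_f` `p`-integral for irreducible
  `E[p]`: `norm_ratPlusSymbol_le_one_of_irreducible`).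
* §4 ★ `exists_unit_symbol_congruence` — under the Kan₂ stub's hypotheses and `vatsal1999_plusSymbol_congruence`: there are
  `u_f, u_g ∈ ℚ̄_p`, `u_g ≠ 0`, `‖u_f‖ ≥ 1`, with `‖u_f φ^{S₀}_W(x)‖ ≤ 1` and `‖u_f φ^{S₀}_W(x) − u_g φ^{S₀}_{g,Ω}(x)‖ < 1` for every
  `x ∈ ℚ` (Vatsal applied to the depleted pair `(f′, g′)` on the common `Γ₀(L)` of K9a; its hypotheses from K7/K8/K9a).

References: [Vatsal1999] §1 (1.1)–(1.2), Thm. (1.6), (1.13), Remark (1.12); [GreenbergVatsal2000] §1 p. 9, §3 (18)–(19);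
[MazurTateTeitelbaum1986Invent] §I.8; [PollackWeston2011MT] §2.2.
-/

set_option autoImplicit false
-- D-0017: single-problem summit, the namespace repeats the problem name by design.
set_option linter.dupNamespace false

noncomputable section

open scoped MatrixGroups ModularForm Classical NNReal

open CongruenceSubgroup Literature.NumberTheory.EllipticCurves Literature.NumberTheory.EllipticCurves.ModularForms Polynomial
  IsDedekindDomain NumberField Rat.HeightOneSpectrum WeierstrassCurve

namespace Summit.BirchSwinnertonDyer.BirchSwinnertonDyer.Theorems.SmallImageRttKan

open Summit.BirchSwinnertonDyer.BirchSwinnertonDyer.Theorems.GL1Cartan.Exc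
  (valuation_le_one_iff valuation_lt_one_iff valuation_eq_one_iff valuation_cuspCoeff_le_one_of_isNewformOf
    valuation_cuspCoeff_le_one_of_isNewform0)
open Summit.BirchSwinnertonDyer.BirchSwinnertonDyer.Theorems.KimAtThreeDeepLowerOffStratumLevelLoweringVatsal
  (plusSymbol_eq_ratPlusSymbol_mul_plusPeriod)
open Summit.BirchSwinnertonDyer.Rank1Residual.Additive (norm_ratPlusSymbol_le_one_of_irreducible)
open Literature.NumberTheory.EllipticCurves.ModularForms.DeligneSerreLift (norm_intCast_le_one norm_intCast_eq_one_of_not_dvd)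

variable {p : ℕ} [hp : Fact p.Prime]

/-! ### §1 The depletion coefficients through `e : ℚ̄_p ≃ ℂ` -/

section Coeff

variable (e : PadicAlgCl p ≃+* ℂ) (S₀ : Finset (HeightOneSpectrum (𝓞 ℚ)))

/-- Curve side: `e⁻¹` of the complex depletion coefficient of `f = f_W` is the `ℚ̄_p`-coefficient built from `L_v(W, X)`
(`a_ℓ(f) = a_ℓ(W) ∈ ℤ`, `L_v(W,X) = 1 − a_ℓX + 𝟙_{ℓ∤N_W}ℓX²`). [cite: GreenbergVatsal2000, §1 p. 9 (display (8))] -/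
theorem symm_coeffProd_curve (W : WeierstrassCurve ℚ) [W.IsElliptic] [W.IsGloballyMinimal] [NeZero (W.conductorNorm ℤ)]
    {f : CuspForm (Gamma0 (W.conductorNorm ℤ)) 2} (hf : IsNewformOf W f) (k : ↥S₀ → ℕ) :
    e.symm (∏ v : ↥S₀, (1 - C (cuspCoeff f (natGenerator (v : HeightOneSpectrum (𝓞 ℚ)))) * X +
        (if natGenerator (v : HeightOneSpectrum (𝓞 ℚ)) ∣ W.conductorNorm ℤ then 0
          else C ((natGenerator (v : HeightOneSpectrum (𝓞 ℚ)) : ℂ))) * X ^ 2 : ℂ[X]).coeff (k v) *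
        (((natGenerator (v : HeightOneSpectrum (𝓞 ℚ)) : ℂ))⁻¹) ^ (k v)) =
      ∏ v : ↥S₀, ((W.localPolynomialAt (v : HeightOneSpectrum (𝓞 ℚ))).map (Int.castRingHom (PadicAlgCl p))).coeff (k v) *
        ((natGenerator (v : HeightOneSpectrum (𝓞 ℚ)) : PadicAlgCl p)⁻¹) ^ (k v) := by
  rw [map_prod]
  refine Finset.prod_congr rfl fun v _ ↦ ?_
  rw [map_mul, map_pow, map_inv₀, map_natCast e.symm, map_localPolynomialAt_eq' W (v : HeightOneSpectrum (𝓞 ℚ))]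
  congr 1
  have hmap : (1 - C (cuspCoeff f (natGenerator (v : HeightOneSpectrum (𝓞 ℚ)))) * X +
      (if natGenerator (v : HeightOneSpectrum (𝓞 ℚ)) ∣ W.conductorNorm ℤ then 0
        else C ((natGenerator (v : HeightOneSpectrum (𝓞 ℚ)) : ℂ))) * X ^ 2 : ℂ[X]).map (e.symm : ℂ →+* PadicAlgCl p) =
      1 - C ((W.LFunction (natGenerator (v : HeightOneSpectrum (𝓞 ℚ))) : PadicAlgCl p)) * X +
        (if natGenerator (v : HeightOneSpectrum (𝓞 ℚ)) ∣ W.conductorNorm ℤ then 0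
          else C (natGenerator (v : HeightOneSpectrum (𝓞 ℚ)) : PadicAlgCl p)) * X ^ 2 := by
    rw [hf.2]
    split_ifs <;> simp [Polynomial.map_sub, Polynomial.map_mul, map_intCast, map_natCast]
  rw [← RingEquiv.coe_toRingHom, ← Polynomial.coeff_map, hmap]

/-- `e⁻¹` is `ι` on `K_g ⊂ ℂ` when `e ∘ ι = id_{K_g}`. [folklore] -/
theorem symm_coe_eq {M : ℕ} {g : CuspForm (Gamma0 M) 2} {ι : coeffField g →+* PadicAlgCl p}
    (he : ∀ z : coeffField g, e (ι z) = (z : ℂ)) (z : coeffField g) : e.symm (z : ℂ) = ι z := by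
  rw [RingEquiv.symm_apply_eq, he]

/-- Partner side: `e⁻¹` of the complex depletion coefficient of `g` is the `ℚ̄_p`-coefficient built from `embCoeff g ι`
(`e⁻¹ a_ℓ(g) = ι a_ℓ(g)`). [cite: GreenbergVatsal2000, §1 p. 9 (display (8))] [cite: PollackWeston2011MT, §2.2] -/
theorem symm_coeffProd_partner {M : ℕ} {g : CuspForm (Gamma0 M) 2} {ι : coeffField g →+* PadicAlgCl p}
    (he : ∀ z : coeffField g, e (ι z) = (z : ℂ)) (k : ↥S₀ → ℕ) :
    e.symm (∏ v : ↥S₀, (1 - C (cuspCoeff g (natGenerator (v : HeightOneSpectrum (𝓞 ℚ)))) * X +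
        (if natGenerator (v : HeightOneSpectrum (𝓞 ℚ)) ∣ M then 0
          else C ((natGenerator (v : HeightOneSpectrum (𝓞 ℚ)) : ℂ))) * X ^ 2 : ℂ[X]).coeff (k v) *
        (((natGenerator (v : HeightOneSpectrum (𝓞 ℚ)) : ℂ))⁻¹) ^ (k v)) =
      ∏ v : ↥S₀, (1 - C (embCoeff g ι (natGenerator (v : HeightOneSpectrum (𝓞 ℚ)))) * X +
          (if natGenerator (v : HeightOneSpectrum (𝓞 ℚ)) ∣ M then 0
            else C (natGenerator (v : HeightOneSpectrum (𝓞 ℚ)) : PadicAlgCl p)) * X ^ 2 : (PadicAlgCl p)[X]).coeff (k v) *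
        ((natGenerator (v : HeightOneSpectrum (𝓞 ℚ)) : PadicAlgCl p)⁻¹) ^ (k v) := by
  rw [map_prod]
  refine Finset.prod_congr rfl fun v _ ↦ ?_
  rw [map_mul, map_pow, map_inv₀, map_natCast e.symm]
  congr 1
  have hsymm : e.symm (cuspCoeff g (natGenerator (v : HeightOneSpectrum (𝓞 ℚ)))) =
      embCoeff g ι (natGenerator (v : HeightOneSpectrum (𝓞 ℚ))) := by
    rw [embCoeff_def, ← symm_coe_eq e he]
  have hmap : (1 - C (cuspCoeff g (natGenerator (v : HeightOneSpectrum (𝓞 ℚ)))) * X +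
      (if natGenerator (v : HeightOneSpectrum (𝓞 ℚ)) ∣ M then 0
        else C ((natGenerator (v : HeightOneSpectrum (𝓞 ℚ)) : ℂ))) * X ^ 2 : ℂ[X]).map (e.symm : ℂ →+* PadicAlgCl p) =
      1 - C (embCoeff g ι (natGenerator (v : HeightOneSpectrum (𝓞 ℚ)))) * X +
        (if natGenerator (v : HeightOneSpectrum (𝓞 ℚ)) ∣ M then 0
          else C (natGenerator (v : HeightOneSpectrum (𝓞 ℚ)) : PadicAlgCl p)) * X ^ 2 := by
    rw [← hsymm]
    split_ifs <;> simp [Polynomial.map_sub, Polynomial.map_mul, map_natCast]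
  rw [← RingEquiv.coe_toRingHom, ← Polynomial.coeff_map, hmap]

end Coeff

/-! ### §2 The depleted forms' symbols through `e` -/

section Symbols

variable (e : PadicAlgCl p ≃+* ℂ) (S₀ : Finset (HeightOneSpectrum (𝓞 ℚ)))

/-- ★ **Curve side.** If `plusSymbol G = ∑_k c_k(f)·plusSymbol f(·∏ℓ^k)` (brick K7) for the newform `f` of `W`, then for every
`Ω_f` and `x`: `e⁻¹(plusSymbol G x / Ω_f) = e⁻¹(Ω⁺_f/Ω_f) · φ^{S₀}_W(x)`, `φ^{S₀}_W` the depleted rational plus symbol of brick K1′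
(`plusSymbol f x = [x]⁺_f · Ω⁺_f`). [cite: MazurTateTeitelbaum1986Invent, §I.8] [cite: GreenbergVatsal2000, §1 p. 9 (display (8))] -/
theorem symm_depletedSymbol_curve (W : WeierstrassCurve ℚ) [W.IsElliptic] [W.IsGloballyMinimal] [NeZero (W.conductorNorm ℤ)]
    {f : CuspForm (Gamma0 (W.conductorNorm ℤ)) 2} (hf : IsNewformOf W f) {L : ℕ} {G : CuspForm (Gamma0 L) 2}
    (hG : ∀ x : ℚ, plusSymbol G x = ∑ k ∈ Fintype.piFinset (fun _ : ↥S₀ ↦ Finset.range 3),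
      (∏ v : ↥S₀, (1 - C (cuspCoeff f (natGenerator (v : HeightOneSpectrum (𝓞 ℚ)))) * X +
          (if natGenerator (v : HeightOneSpectrum (𝓞 ℚ)) ∣ W.conductorNorm ℤ then 0
            else C ((natGenerator (v : HeightOneSpectrum (𝓞 ℚ)) : ℂ))) * X ^ 2 : ℂ[X]).coeff (k v) *
        (((natGenerator (v : HeightOneSpectrum (𝓞 ℚ)) : ℂ))⁻¹) ^ (k v)) *
      plusSymbol f (x * ((∏ v : ↥S₀, natGenerator (v : HeightOneSpectrum (𝓞 ℚ)) ^ (k v) : ℕ) : ℚ)))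
    (Ωf : ℂ) (x : ℚ) :
    e.symm (plusSymbol G x / Ωf) = e.symm (((plusPeriod f : ℝ) : ℂ) / Ωf) *
      ∑ k ∈ Fintype.piFinset (fun _ : ↥S₀ ↦ Finset.range 3),
        (∏ v : ↥S₀, ((W.localPolynomialAt (v : HeightOneSpectrum (𝓞 ℚ))).map (Int.castRingHom (PadicAlgCl p))).coeff (k v) *
          ((natGenerator (v : HeightOneSpectrum (𝓞 ℚ)) : PadicAlgCl p)⁻¹) ^ (k v)) *
        algebraMap ℚ (PadicAlgCl p) (ratPlusSymbol f
          (x * ((∏ v : ↥S₀, natGenerator (v : HeightOneSpectrum (𝓞 ℚ)) ^ (k v) : ℕ) : ℚ))) := by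
  rw [hG x, Finset.sum_div, map_sum, Finset.mul_sum]
  refine Finset.sum_congr rfl fun k _ ↦ ?_
  rw [plusSymbol_eq_ratPlusSymbol_mul_plusPeriod hf, ← symm_coeffProd_curve e S₀ W hf k,
    show ∀ (c r Ω : ℂ), c * (r * Ω) / Ωf = c * r * (Ω / Ωf) from fun c r Ω ↦ by ring, map_mul, map_mul, map_ratCast,
    ← eq_ratCast (algebraMap ℚ (PadicAlgCl p))]
  ring

/-- ★ **Partner side.** If `plusSymbol G = ∑_k c_k(g)·plusSymbol g(·∏ℓ^k)` (brick K7) and `Ω` is a Shimura period of `g` with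
`e ∘ ι = id_{K_g}`, then `e⁻¹(plusSymbol G x / Ω_g) = e⁻¹(Ω/Ω_g) · φ^{S₀}_{g,Ω}(x)`, `φ^{S₀}_{g,Ω}` the depleted symbol `ι[·]⁺_{g,Ω}` of
brick K1′. [cite: PollackWeston2011MT, §2.2] [cite: GreenbergVatsal2000, §1 p. 9 (display (8))] -/
theorem symm_depletedSymbol_partner {M : ℕ} [NeZero M] {g : CuspForm (Gamma0 M) 2} {ι : coeffField g →+* PadicAlgCl p}
    (he : ∀ z : coeffField g, e (ι z) = (z : ℂ)) {Ω : ℂ} (hΩ : IsPlusPeriod g Ω) {L : ℕ} {G : CuspForm (Gamma0 L) 2}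
    (hG : ∀ x : ℚ, plusSymbol G x = ∑ k ∈ Fintype.piFinset (fun _ : ↥S₀ ↦ Finset.range 3),
      (∏ v : ↥S₀, (1 - C (cuspCoeff g (natGenerator (v : HeightOneSpectrum (𝓞 ℚ)))) * X +
          (if natGenerator (v : HeightOneSpectrum (𝓞 ℚ)) ∣ M then 0
            else C ((natGenerator (v : HeightOneSpectrum (𝓞 ℚ)) : ℂ))) * X ^ 2 : ℂ[X]).coeff (k v) *
        (((natGenerator (v : HeightOneSpectrum (𝓞 ℚ)) : ℂ))⁻¹) ^ (k v)) *
      plusSymbol g (x * ((∏ v : ↥S₀, natGenerator (v : HeightOneSpectrum (𝓞 ℚ)) ^ (k v) : ℕ) : ℚ)))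
    (Ωg : ℂ) (x : ℚ) :
    e.symm (plusSymbol G x / Ωg) = e.symm (Ω / Ωg) *
      ∑ k ∈ Fintype.piFinset (fun _ : ↥S₀ ↦ Finset.range 3),
        (∏ v : ↥S₀, (1 - C (embCoeff g ι (natGenerator (v : HeightOneSpectrum (𝓞 ℚ)))) * X +
            (if natGenerator (v : HeightOneSpectrum (𝓞 ℚ)) ∣ M then 0
              else C (natGenerator (v : HeightOneSpectrum (𝓞 ℚ)) : PadicAlgCl p)) * X ^ 2 : (PadicAlgCl p)[X]).coeff (k v) *
          ((natGenerator (v : HeightOneSpectrum (𝓞 ℚ)) : PadicAlgCl p)⁻¹) ^ (k v)) *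
        ι (plusSymbolK g Ω (x * ((∏ v : ↥S₀, natGenerator (v : HeightOneSpectrum (𝓞 ℚ)) ^ (k v) : ℕ) : ℚ))) := by
  rw [hG x, Finset.sum_div, map_sum, Finset.mul_sum]
  refine Finset.sum_congr rfl fun k _ ↦ ?_
  have hsplit : ∀ (c P : ℂ), c * P / Ωg = c * (P / Ω) * (Ω / Ωg) := fun c P ↦ by
    field_simp [hΩ.ne_zero]
  rw [hsplit, ← hΩ.coe_plusSymbolK, map_mul, map_mul, symm_coe_eq e he, ← symm_coeffProd_partner e S₀ he k]
  ring

end Symbols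

/-! ### §3 Integrality of the curve's depleted symbol -/

section Integral

variable (S₀ : Finset (HeightOneSpectrum (𝓞 ℚ)))

/-- `‖(r : ℚ̄_p)‖ = ‖(r : ℚ_p)‖` for `r ∈ ℚ`. [folklore] -/
theorem norm_ratCast_padicAlgCl (r : ℚ) : ‖(r : PadicAlgCl p)‖ = ‖(r : ℚ_[p])‖ := by
  rw [← map_ratCast (algebraMap ℚ_[p] (PadicAlgCl p)) r]
  exact PadicAlgCl.norm_extends (p := p) _

/-- The coefficients of `L_v(W, X) ∈ ℤ[X]` are `p`-adically integral and `ℓ_v ≠ p` is a `p`-adic unit, so the depletion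
coefficient `∏_v coeff_{k_v}(L_v) ℓ_v^{−k_v}` has norm `≤ 1`. [folklore] -/
theorem norm_coeffProd_curve_le_one (W : WeierstrassCurve ℚ) (hS : ∀ v ∈ S₀, natGenerator v ≠ p) (k : ↥S₀ → ℕ) :
    ‖∏ v : ↥S₀, ((W.localPolynomialAt (v : HeightOneSpectrum (𝓞 ℚ))).map (Int.castRingHom (PadicAlgCl p))).coeff (k v) *
        ((natGenerator (v : HeightOneSpectrum (𝓞 ℚ)) : PadicAlgCl p)⁻¹) ^ (k v)‖ ≤ 1 := by
  rw [norm_prod]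
  refine Finset.prod_le_one (fun v _ ↦ norm_nonneg _) fun v _ ↦ ?_
  have hℓ : ‖(natGenerator (v : HeightOneSpectrum (𝓞 ℚ)) : PadicAlgCl p)‖ = 1 := by
    have h := norm_intCast_eq_one_of_not_dvd (p := p) (z := ((natGenerator (v : HeightOneSpectrum (𝓞 ℚ)) : ℕ) : ℤ))
      (by
        rw [Int.natCast_dvd_natCast]
        intro hdvd
        exact hS v v.2 ((Nat.prime_dvd_prime_iff_eq hp.out (prime_natGenerator _)).mp hdvd).symm)
    rwa [Int.cast_natCast] at h
  rw [norm_mul, norm_pow, norm_inv, hℓ, inv_one, one_pow, mul_one, Polynomial.coeff_map, eq_intCast]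
  exact norm_intCast_le_one _

/-- ★ **`‖φ^{S₀}_W(x)‖ ≤ 1`**: the curve's depleted rational plus symbol is `p`-integral at every `x ∈ ℚ`, for `p` odd with
`E[p]` irreducible (all-`r` integrality of `[r]⁺_f`, `norm_ratPlusSymbol_le_one_of_irreducible`; integral depletion
coefficients). [cite: GreenbergVatsal2000, §3 (18)–(19) and Prop. (3.7)] -/
theorem norm_depletedSymbol_curve_le_one (W : WeierstrassCurve ℚ) [W.IsElliptic] [W.IsGloballyMinimal] (hp2 : p ≠ 2)
    {N : ℕ} [NeZero N] {f : CuspForm (Gamma0 N) 2} (hf : IsNewformOf W f) (hirr : W.HasIrreducibleModPGaloisRep p)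
    (hS : ∀ v ∈ S₀, natGenerator v ≠ p) (x : ℚ) :
    ‖∑ k ∈ Fintype.piFinset (fun _ : ↥S₀ ↦ Finset.range 3),
        (∏ v : ↥S₀, ((W.localPolynomialAt (v : HeightOneSpectrum (𝓞 ℚ))).map (Int.castRingHom (PadicAlgCl p))).coeff (k v) *
          ((natGenerator (v : HeightOneSpectrum (𝓞 ℚ)) : PadicAlgCl p)⁻¹) ^ (k v)) *
        algebraMap ℚ (PadicAlgCl p) (ratPlusSymbol f
          (x * ((∏ v : ↥S₀, natGenerator (v : HeightOneSpectrum (𝓞 ℚ)) ^ (k v) : ℕ) : ℚ)))‖ ≤ 1 := by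
  refine IsUltrametricDist.norm_sum_le_of_forall_le_of_nonneg zero_le_one fun k _ ↦ ?_
  rw [norm_mul]
  refine mul_le_one₀ (norm_coeffProd_curve_le_one S₀ W hS k) (norm_nonneg _) ?_
  rw [eq_ratCast, norm_ratCast_padicAlgCl]
  exact norm_ratPlusSymbol_le_one_of_irreducible hp2 hf hirr _

end Integral

/-! ### §4 Vatsal's congruence on the depleted pair, read on the depleted symbols -/

section Export

/-- ★ **The unit-ratio symbol congruence** (CONDITIONAL on the printed input `vatsal1999_plusSymbol_congruence`, taken by
name). Under the Kan₂ stub's hypotheses — `p` odd of class X7 (good supersingular, non-semistable `W`), `a_p(W) = 0`, a newform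
`g ∈ S₂(Γ₀(M))` with `p ∤ M`, `max(2, v_ℓ M) = max(2, v_ℓ N_W)` (`ℓ ≠ p`), `a_p(g) = 0`, a Shimura period `Ω`, `ι : K_g → ℚ̄_p`
with `ι a_ℓ(g) ≡ a_ℓ(W)` at the primes `ℓ ∤ pMN_W`, the newform `f` of `W`, and places `S₀ ∌ p` containing the bad places of `W`
and the places of `M` — there are `u_f, u_g ∈ ℚ̄_p` with `u_g ≠ 0`, `‖u_f‖ ≥ 1`, and for every `x ∈ ℚ`:
`‖u_f φ^{S₀}_W(x)‖ ≤ 1` and `‖u_f φ^{S₀}_W(x) − u_g φ^{S₀}_{g,Ω}(x)‖ < 1`, where `φ^{S₀}_W`, `φ^{S₀}_{g,Ω}` are the depleted plus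
symbols of brick K1′. Proof: Vatsal's Thm. (1.6)/(1.13) for the depleted pair `(f′, g′)` of brick K7 on the common `Γ₀(L)` of
brick K9a (Condition 1 from K7; integrality, number field, congruence at all `n` from K8/K9a; `E[p]` irreducible as `p ∣ a_p`,
`p` odd of good reduction), then §2 (`u_f = e⁻¹(Ω⁺_f/Ω_f)`, `u_g = e⁻¹(Ω/Ω_g)`) and §3 with Vatsal's unit value for `‖u_f‖ ≥ 1`.
[cite: Vatsal1999, Thm. (1.6), (1.13), Remark (1.12)] [cite: GreenbergVatsal2000, §3 (18)–(19)] -/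
theorem exists_unit_symbol_congruence (hV : vatsal1999_plusSymbol_congruence) (W : WeierstrassCurve ℚ) [W.IsElliptic]
    [W.IsGloballyMinimal] (hp2 : p ≠ 2) (hX7 : Rank1Residual.ClassX7 W p) (hap : W.frobeniusTrace p = 0)
    {M : ℕ} [NeZero M] {g : CuspForm (Gamma0 M) 2} (ι : coeffField g →+* PadicAlgCl p) {Ω : ℂ} (hpM : ¬ p ∣ M)
    (hlev : ∀ ℓ : ℕ, ℓ.Prime → ℓ ≠ p → max 2 (padicValNat ℓ M) = max 2 (padicValNat ℓ (W.conductorNorm ℤ)))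
    (hg : IsNewform0 g) (hgp : cuspCoeff g p = 0) (hΩ : IsPlusPeriod g Ω)
    (hcong : ∀ ℓ : ℕ, ℓ.Prime → ¬ ℓ ∣ p * M * W.conductorNorm ℤ →
      ‖embCoeff g ι ℓ - (W.frobeniusTrace ℓ : PadicAlgCl p)‖ < 1)
    [NeZero (W.conductorNorm ℤ)] {f : CuspForm (Gamma0 (W.conductorNorm ℤ)) 2} (hf : IsNewformOf W f)
    (S₀ : Finset (HeightOneSpectrum (𝓞 ℚ))) (hS : ∀ v ∈ S₀, natGenerator v ≠ p)
    (hbad : ∀ v : HeightOneSpectrum (𝓞 ℚ), ¬ W.HasGoodReductionAt v → v ∈ S₀)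
    (hM : ∀ v : HeightOneSpectrum (𝓞 ℚ), natGenerator v ∣ M → v ∈ S₀) :
    ∃ uf ug : PadicAlgCl p, ug ≠ 0 ∧ 1 ≤ ‖uf‖ ∧
      (∀ x : ℚ, ‖uf * ∑ k ∈ Fintype.piFinset (fun _ : ↥S₀ ↦ Finset.range 3),
        (∏ v : ↥S₀, ((W.localPolynomialAt (v : HeightOneSpectrum (𝓞 ℚ))).map (Int.castRingHom (PadicAlgCl p))).coeff (k v) *
          ((natGenerator (v : HeightOneSpectrum (𝓞 ℚ)) : PadicAlgCl p)⁻¹) ^ (k v)) *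
        algebraMap ℚ (PadicAlgCl p) (ratPlusSymbol f
          (x * ((∏ v : ↥S₀, natGenerator (v : HeightOneSpectrum (𝓞 ℚ)) ^ (k v) : ℕ) : ℚ)))‖ ≤ 1) ∧
      (∀ x : ℚ, ‖uf * ∑ k ∈ Fintype.piFinset (fun _ : ↥S₀ ↦ Finset.range 3),
        (∏ v : ↥S₀, ((W.localPolynomialAt (v : HeightOneSpectrum (𝓞 ℚ))).map (Int.castRingHom (PadicAlgCl p))).coeff (k v) *
          ((natGenerator (v : HeightOneSpectrum (𝓞 ℚ)) : PadicAlgCl p)⁻¹) ^ (k v)) *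
        algebraMap ℚ (PadicAlgCl p) (ratPlusSymbol f
          (x * ((∏ v : ↥S₀, natGenerator (v : HeightOneSpectrum (𝓞 ℚ)) ^ (k v) : ℕ) : ℚ))) -
        ug * ∑ k ∈ Fintype.piFinset (fun _ : ↥S₀ ↦ Finset.range 3),
        (∏ v : ↥S₀, (1 - C (embCoeff g ι (natGenerator (v : HeightOneSpectrum (𝓞 ℚ)))) * X +
            (if natGenerator (v : HeightOneSpectrum (𝓞 ℚ)) ∣ M then 0
              else C (natGenerator (v : HeightOneSpectrum (𝓞 ℚ)) : PadicAlgCl p)) * X ^ 2 : (PadicAlgCl p)[X]).coeff (k v) *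
          ((natGenerator (v : HeightOneSpectrum (𝓞 ℚ)) : PadicAlgCl p)⁻¹) ^ (k v)) *
        ι (plusSymbolK g Ω (x * ((∏ v : ↥S₀, natGenerator (v : HeightOneSpectrum (𝓞 ℚ)) ^ (k v) : ℕ) : ℚ)))‖ < 1) := by
  classical
  obtain ⟨⟨hgood, hpap⟩, hns⟩ := hX7
  -- the common level `L` of the two depleted forms (brick K9a)
  obtain ⟨L, hL⟩ : ∃ L : ℕ, L = W.conductorNorm ℤ *
      ∏ v ∈ S₀, natGenerator v ^ (2 - min 2 (padicValNat (natGenerator v) (W.conductorNorm ℤ))) := ⟨_, rfl⟩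
  have hLg : L = M * ∏ v ∈ S₀, natGenerator v ^ (2 - min 2 (padicValNat (natGenerator v) M)) := by
    rw [hL]; exact level_eq_of_places W S₀ hS hbad hM hlev
  haveI : NeZero L := ⟨by
    rw [hL]
    exact mul_ne_zero (NeZero.ne _)
      (Finset.prod_ne_zero_iff.mpr fun v _ ↦ pow_ne_zero _ (prime_natGenerator v).ne_zero)⟩
  have hpN : ¬ p ∣ W.conductorNorm ℤ := not_dvd_conductorNorm_of_hasGoodReductionAtPrime W hgood
  have hpL : ¬ p ∣ L := hL ▸ not_dvd_level S₀ _ _ (fun v _ ↦ prime_natGenerator v) hp.out hpN hS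
  have h4L : 4 ≤ L := hL ▸ (four_le_conductorNorm_of_not_semistable W hns).trans
    (le_level S₀ _ _ (fun v _ ↦ prime_natGenerator v) _)
  have hℓL : ∀ v ∈ S₀, natGenerator v ∣ L := fun v hv ↦ hL ▸ dvd_level S₀ _ _ hv
  -- the depleted forms (brick K7)
  obtain ⟨Gf, hfe, hfn, hfC, -, hqf, hsf⟩ := exists_depletedForm hf.1 S₀ L hL
  obtain ⟨Gg, hge, hgn, hgC, -, hqg, hsg⟩ := exists_depletedForm hg S₀ L hLg
  -- `e : ℚ̄_p ≃ ℂ` extending `ι`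
  haveI : FiniteDimensional ℚ (coeffField g) := IsNewform0.finiteDimensional_coeffField_holds hg
  haveI : NumberField (coeffField g) := NumberField.mk
  obtain ⟨e, he'⟩ := DeligneSerre1974.exists_ringEquiv_padicAlgCl_complex_extends ι (algebraMap (coeffField g) ℂ)
  have he : ∀ z : coeffField g, e (ι z) = (z : ℂ) := fun z ↦ (he' z).trans (IntermediateField.algebraMap_apply _ z)
  -- Vatsal's hypotheses for `(Gf, Gg)` on `Γ₀(L)`
  have hif : ∀ n : ℕ, Valued.v (e.symm (cuspCoeff f n)) ≤ 1 := valuation_cuspCoeff_le_one_of_isNewformOf hf e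
  have hig : ∀ n : ℕ, Valued.v (e.symm (cuspCoeff g n)) ≤ 1 := valuation_cuspCoeff_le_one_of_isNewform0 hg e
  have hirr : W.HasIrreducibleModPGaloisRep p := hasIrreducibleModPGaloisRep_of_dvd_frobeniusTrace W p hp2
    (not_dvd_minimalDiscriminantInt_of_hasGoodReductionAtPrime' W p hgood) hpap
  have hsymm : ∀ n : ℕ, e.symm (cuspCoeff g n) = embCoeff g ι n := fun n ↦ by
    rw [embCoeff_def, ← symm_coe_eq e he]
  have hfg : ∀ q : ℕ, q.Prime → (∀ v ∈ S₀, natGenerator v ≠ q) →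
      Valued.v (e.symm (cuspCoeff f q - cuspCoeff g q)) < 1 := by
    intro q hq hqS
    obtain ⟨v, hv⟩ : ∃ v : HeightOneSpectrum (𝓞 ℚ), natGenerator v = q :=
      ⟨(primesEquiv (R := 𝓞 ℚ)).symm ⟨q, hq⟩, congrArg Subtype.val ((primesEquiv (R := 𝓞 ℚ)).apply_symm_apply ⟨q, hq⟩)⟩
    have hqN : ¬ q ∣ W.conductorNorm ℤ := fun h ↦
      hqS v (hbad v ((W.dvd_conductorNorm_iff v).mp (show natGenerator v ∣ _ by rwa [hv]))) hv
    have hqM : ¬ q ∣ M := fun h ↦ hqS v (hM v (hv ▸ h)) hv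
    haveI : Fact q.Prime := ⟨hq⟩
    have hgoodq : W.HasGoodReductionAtPrime q := by
      by_contra h
      exact hqN ((W.dvd_conductorNorm_iff_not_hasGoodReductionAtPrime q).mpr h)
    rw [hf.2 q, W.LFunction_apply_prime_eq_frobeniusTrace q hgoodq]
    by_cases hqp : q = p
    · subst hqp
      rw [hap, hgp, Int.cast_zero, sub_zero, map_zero, Valuation.map_zero]
      exact zero_lt_one
    · have hndvd : ¬ q ∣ p * M * W.conductorNorm ℤ := by
        intro h
        rcases (Nat.Prime.dvd_mul hq).mp h with h | h
        · rcases (Nat.Prime.dvd_mul hq).mp h with h | h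
          · exact hqp ((Nat.prime_dvd_prime_iff_eq hq hp.out).mp h)
          · exact hqM h
        · exact hqN h
      have h := hcong q hq hndvd
      rw [valuation_lt_one_iff, map_sub, map_intCast, hsymm, ← norm_neg, neg_sub]
      exact h
  have hcongG : ∀ n : ℕ, Valued.v (e.symm (cuspCoeff Gf n - cuspCoeff Gg n)) < 1 :=
    valuation_cuspCoeff_depleted_sub_lt_one S₀ e hfe hge hfn hgn hif hig hqf hqg hfg
  have hWc : ∀ ℓ : ℕ, ℓ.Prime → ¬ ℓ ∣ L * p → Valued.v (e.symm (cuspCoeff Gf ℓ - (W.LFunction ℓ : ℂ))) < 1 :=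
    fun ℓ hℓ hℓL' ↦ valuation_cuspCoeff_depleted_sub_LFunction S₀ e W hf hqf hℓL hℓ hℓL'
  -- Vatsal 1999, Thm. (1.6)/(1.13), for the depleted pair
  obtain ⟨Ωf, Ωg, -, hΩg0, hintf, -, hcg, x₁, hx₁⟩ := hV p L e W Gf Gg hp2 hpL h4L hfe hfn
    (finiteDimensional_coeffField_depleted S₀ hqf (IsNewform0.finiteDimensional_coeffField_holds hf.1))
    (valuation_cuspCoeff_depleted_le_one S₀ e hqf hif) hfC hge hgn
    (finiteDimensional_coeffField_depleted S₀ hqg inferInstance)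
    (valuation_cuspCoeff_depleted_le_one S₀ e hqg hig) hgC hcongG hirr hWc
  -- read on the depleted symbols
  refine ⟨e.symm (((plusPeriod f : ℝ) : ℂ) / Ωf), e.symm (Ω / Ωg),
    (map_ne_zero e.symm).mpr (div_ne_zero hΩ.ne_zero hΩg0), ?_, fun x ↦ ?_, fun x ↦ ?_⟩
  · -- `‖u_f‖ ≥ 1` from Vatsal's unit value and `‖φ^{S₀}_W(x₁)‖ ≤ 1`
    have h1 := valuation_eq_one_iff.mp hx₁
    rw [symm_depletedSymbol_curve e S₀ W hf hsf Ωf x₁, norm_mul] at h1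
    have hA := norm_depletedSymbol_curve_le_one (p := p) S₀ W hp2 hf hirr hS x₁
    by_contra hlt
    push Not at hlt
    have h2 := mul_le_of_le_one_right (norm_nonneg (e.symm (((plusPeriod f : ℝ) : ℂ) / Ωf))) hA
    linarith
  · rw [← symm_depletedSymbol_curve e S₀ W hf hsf Ωf x]
    exact valuation_le_one_iff.mp (hintf x)
  · rw [← symm_depletedSymbol_curve e S₀ W hf hsf Ωf x, ← symm_depletedSymbol_partner e S₀ he hΩ hsg Ωg x, ← map_sub]
    exact valuation_lt_one_iff.mp (hcg x)

end Export

end Summit.BirchSwinnertonDyer.BirchSwinnertonDyer.Theorems.SmallImageRttKan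

end
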